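import Literature.RepresentationTheory.HeisenbergGroup.ImplementerIntertwinerTransport
import Literature.RepresentationTheory.HeisenbergGroup.ImplementerCocycle
import HarnessLib

/-!
# `S̃p_ψ` is functorial in (Heisenberg isomorphism, intertwiner): `MpPsi ρ₁ ≃* MpPsi ρ₂` along `(Φ, T, φ)`

Topic `RepresentationTheory/HeisenbergGroup`; namespace `Literature.RepresentationTheory.HeisenbergGroup`.  KERNEL only
(one definition with body + theorems; no named fact, no `sorry`).  Sequel of `ImplementerIntertwinerTransport`
(B-p19: transport of condition (A) along an isomorphism of Heisenberg groups `Φ : H(B₁) ≃* H(B₂)`, an intertwiner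
`T : S₁ ≃ S₂` with `T ρ₁(h) = ρ₂(Φ h) T`, and a map `φ : Sp(B₁) → Sp(B₂)` compatible with Weil's sections,
`Φ ((ofSymplectic B₁ g)·h) = (ofSymplectic B₂ (φ g))·(Φ h)`).  Packaged as a GROUP ISOMORPHISM of MVW's groups of pairs:

* **`MpPsi.congr hT hφ : MpPsi ρ₁ ≃* MpPsi ρ₂`**, `(g, M) ↦ (φ g, T M T⁻¹)` (for `φ : Sp(B₁) ≃* Sp(B₂)`);
* `MpPsi.proj_congr` — it lies over `φ`; `MpPsi.toRep_congr_apply` — **`ω(congr p) (T f) = T (ω(p) f)`**: `T` intertwines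
  the two tautological (Weil) representations; `MpPsi.congr_ofScalar` — scalars go to scalars;
* for a homomorphism `s : G →* MpPsi ρ₁`: `MpPsi.proj_congr_comp`, `MpPsi.toRep_congr_comp_apply` — the section
  `congr ∘ s` lies over `φ ∘ (proj ∘ s)` and its Weil representation is `T ω_s T⁻¹`.

[MoeglinVignerasWaldspurger1987, Chap. 2 II.1 (A)–(B) and Remarque (3)] («`GSp(W)` opère par conjugaison sur `H` et sur
`S̃p_ψ(W)`»; «À isomorphisme près, il est indépendant de la réalisation», I.7).  Consumer: transport of the rank-one theta
currency along a rational change of frame `T ↦ PᵀTP` (route R for row IV-4c3 of the Hodge/COR-CM interface, piece R1d-ii).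
HC_CM is NOT proved here.

## References
* [MoeglinVignerasWaldspurger1987] C. Mœglin, M.-F. Vignéras, J.-L. Waldspurger, LNM 1291 (1987), Chap. 2 I.7, II.1 (A)–(B),
  II Remarques (2)–(3).
* [Weil1964] A. Weil, *Sur certains groupes d'opérateurs unitaires*, Acta Math. 111 (1964), n° 5, n° 34.
-/

set_option autoImplicit false

noncomputable section

namespace Literature.RepresentationTheory.HeisenbergGroup

section Congr

variable {R₁ : Type*} [CommRing R₁] [Invertible (2 : R₁)] {V₁ : Type*} [AddCommGroup V₁] [Module R₁ V₁]
  {B₁ : V₁ →ₗ[R₁] V₁ →ₗ[R₁] R₁}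
variable {R₂ : Type*} [CommRing R₂] [Invertible (2 : R₂)] {V₂ : Type*} [AddCommGroup V₂] [Module R₂ V₂]
  {B₂ : V₂ →ₗ[R₂] V₂ →ₗ[R₂] R₂}
variable {k : Type*} [Field k] {S₁ : Type*} [AddCommGroup S₁] [Module k S₁]
  {S₂ : Type*} [AddCommGroup S₂] [Module k S₂]
variable (ρ₁ : Representation k (Heisenberg B₁) S₁) (ρ₂ : Representation k (Heisenberg B₂) S₂)
variable {Φ : Heisenberg B₁ ≃* Heisenberg B₂} {T : S₁ ≃ₗ[k] S₂} {φ : symplecticGroup B₁ ≃* symplecticGroup B₂}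
  (hT : ∀ (h : Heisenberg B₁) (f : S₁), T (ρ₁ h f) = ρ₂ (Φ h) (T f))
  (hφ : ∀ (g : symplecticGroup B₁) (h : Heisenberg B₁), Φ ((ofSymplectic B₁ g).act h) = (ofSymplectic B₂ (φ g)).act (Φ h))

include hφ in
/-- (C) backwards along the symplectic isomorphism: `Φ⁻¹ ((ofSymplectic B₂ g₂)·h₂) = (ofSymplectic B₁ (φ⁻¹ g₂))·(Φ⁻¹ h₂)`.
[cite: Weil1964, n° 5, p. 150] -/
theorem ofSymplectic_act_symm (g₂ : symplecticGroup B₂) (h₂ : Heisenberg B₂) :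
    Φ.symm ((ofSymplectic B₂ g₂).act h₂) = (ofSymplectic B₁ (φ.symm g₂)).act (Φ.symm h₂) := by
  rw [MulEquiv.symm_apply_eq, hφ, MulEquiv.apply_symm_apply, MulEquiv.apply_symm_apply]

include hT hφ in
/-- the forward pair `(φ g, T M T⁻¹)` satisfies (A) for `ρ₂` when `(g, M)` does for `ρ₁`.
[cite: MoeglinVignerasWaldspurger1987, Chap. 2 II.1 (A)] -/
theorem congr_mem (p : MpPsi ρ₁) :
    ((φ (p : symplecticGroup B₁ × (S₁ ≃ₗ[k] S₁)).1, T.symm ≪≫ₗ (p : symplecticGroup B₁ × (S₁ ≃ₗ[k] S₁)).2 ≪≫ₗ T) :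
      symplecticGroup B₂ × (S₂ ≃ₗ[k] S₂)) ∈ MpPsi ρ₂ :=
  (mem_MpPsi ρ₂ _).2 (Implements.intertwinerConj hT (hφ _) ((mem_MpPsi ρ₁ _).1 p.2))

include hT hφ in
/-- the backward pair `(φ⁻¹ g₂, T⁻¹ M₂ T)` satisfies (A) for `ρ₁` when `(g₂, M₂)` does for `ρ₂`.
[cite: MoeglinVignerasWaldspurger1987, Chap. 2 II.1 (A)] -/
theorem congr_symm_mem (q : MpPsi ρ₂) :
    ((φ.symm (q : symplecticGroup B₂ × (S₂ ≃ₗ[k] S₂)).1, T ≪≫ₗ (q : symplecticGroup B₂ × (S₂ ≃ₗ[k] S₂)).2 ≪≫ₗ T.symm) :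
      symplecticGroup B₁ × (S₁ ≃ₗ[k] S₁)) ∈ MpPsi ρ₁ := by
  refine (mem_MpPsi ρ₁ _).2 (Implements.intertwinerConj_symm hT (fun h => ?_) ((mem_MpPsi ρ₂ _).1 q.2))
  rw [hφ, MulEquiv.apply_symm_apply]

/-- **`S̃p_ψ` along `(Φ, T, φ)`: `MpPsi ρ₁ ≃* MpPsi ρ₂`, `(g, M) ↦ (φ g, T M T⁻¹)`.**
[cite: MoeglinVignerasWaldspurger1987, Chap. 2 II Remarque (3)] -/
def MpPsi.congr : MpPsi ρ₁ ≃* MpPsi ρ₂ where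
  toFun p := ⟨_, congr_mem ρ₁ ρ₂ hT hφ p⟩
  invFun q := ⟨_, congr_symm_mem ρ₁ ρ₂ hT hφ q⟩
  left_inv p := by
    refine Subtype.ext (Prod.ext (φ.symm_apply_apply _) (LinearEquiv.ext fun f => ?_))
    simp only [LinearEquiv.trans_apply, LinearEquiv.symm_apply_apply]
  right_inv q := by
    refine Subtype.ext (Prod.ext (φ.apply_symm_apply _) (LinearEquiv.ext fun g => ?_))
    simp only [LinearEquiv.trans_apply, LinearEquiv.apply_symm_apply]
  map_mul' p p' := by
    refine Subtype.ext (Prod.ext ?_ (LinearEquiv.ext fun g => ?_))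
    · change φ ((p * p' : MpPsi ρ₁) : symplecticGroup B₁ × (S₁ ≃ₗ[k] S₁)).1 = φ _ * φ _
      rw [Subgroup.coe_mul, Prod.fst_mul, map_mul]
    · change (T.symm ≪≫ₗ ((p * p' : MpPsi ρ₁) : symplecticGroup B₁ × (S₁ ≃ₗ[k] S₁)).2 ≪≫ₗ T) g =
        ((T.symm ≪≫ₗ (p : symplecticGroup B₁ × (S₁ ≃ₗ[k] S₁)).2 ≪≫ₗ T) *
          (T.symm ≪≫ₗ (p' : symplecticGroup B₁ × (S₁ ≃ₗ[k] S₁)).2 ≪≫ₗ T)) g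
      rw [Subgroup.coe_mul, Prod.snd_mul]
      simp only [LinearEquiv.trans_apply, LinearEquiv.mul_apply, LinearEquiv.symm_apply_apply]

/-- underlying pair of `congr p`. [cite: MoeglinVignerasWaldspurger1987, Chap. 2 II Remarque (3)] -/
theorem MpPsi.coe_congr (p : MpPsi ρ₁) :
    ((MpPsi.congr ρ₁ ρ₂ hT hφ p : MpPsi ρ₂) : symplecticGroup B₂ × (S₂ ≃ₗ[k] S₂)) =
      (φ (p : symplecticGroup B₁ × (S₁ ≃ₗ[k] S₁)).1, T.symm ≪≫ₗ (p : symplecticGroup B₁ × (S₁ ≃ₗ[k] S₁)).2 ≪≫ₗ T) := rfl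

/-- underlying pair of `congr.symm q`. [cite: MoeglinVignerasWaldspurger1987, Chap. 2 II Remarque (3)] -/
theorem MpPsi.coe_congr_symm (q : MpPsi ρ₂) :
    (((MpPsi.congr ρ₁ ρ₂ hT hφ).symm q : MpPsi ρ₁) : symplecticGroup B₁ × (S₁ ≃ₗ[k] S₁)) =
      (φ.symm (q : symplecticGroup B₂ × (S₂ ≃ₗ[k] S₂)).1, T ≪≫ₗ (q : symplecticGroup B₂ × (S₂ ≃ₗ[k] S₂)).2 ≪≫ₗ T.symm) := rfl

/-- **`congr` lies over `φ`**: `proj (congr p) = φ (proj p)`. [cite: MoeglinVignerasWaldspurger1987, Chap. 2 II.1 (B)] -/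
@[simp] theorem MpPsi.proj_congr (p : MpPsi ρ₁) :
    MpPsi.proj ρ₂ (MpPsi.congr ρ₁ ρ₂ hT hφ p) = φ (MpPsi.proj ρ₁ p) := rfl

/-- **`T` intertwines the tautological representations**: `ω(congr p) (T f) = T (ω(p) f)`.
[cite: MoeglinVignerasWaldspurger1987, Chap. 2 I.7] -/
@[simp] theorem MpPsi.toRep_congr_apply (p : MpPsi ρ₁) (f : S₁) :
    MpPsi.toRep ρ₂ (MpPsi.congr ρ₁ ρ₂ hT hφ p) (T f) = T (MpPsi.toRep ρ₁ p f) := by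
  rw [MpPsi.toRep_apply, MpPsi.toRep_apply, MpPsi.coe_congr]
  simp only [LinearEquiv.trans_apply, LinearEquiv.symm_apply_apply]

/-- the same with `T⁻¹` on the other side: `ω(congr p) g = T (ω(p) (T⁻¹ g))`. [cite: MoeglinVignerasWaldspurger1987, Chap. 2 I.7] -/
theorem MpPsi.toRep_congr_apply' (p : MpPsi ρ₁) (g : S₂) :
    MpPsi.toRep ρ₂ (MpPsi.congr ρ₁ ρ₂ hT hφ p) g = T (MpPsi.toRep ρ₁ p (T.symm g)) := by
  rw [← MpPsi.toRep_congr_apply ρ₁ ρ₂ hT hφ, LinearEquiv.apply_symm_apply]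

/-- **scalars go to scalars**: `congr (i c) = i c`. [cite: MoeglinVignerasWaldspurger1987, Chap. 2 II.1 (B)] -/
@[simp] theorem MpPsi.congr_ofScalar (c : kˣ) :
    MpPsi.congr ρ₁ ρ₂ hT hφ (MpPsi.ofScalar ρ₁ c) = MpPsi.ofScalar ρ₂ c := by
  refine Subtype.ext (Prod.ext ?_ (LinearEquiv.ext fun g => ?_))
  · rw [MpPsi.coe_congr, MpPsi.coe_ofScalar, MpPsi.coe_ofScalar, map_one]
  · rw [MpPsi.coe_congr, MpPsi.coe_ofScalar, MpPsi.coe_ofScalar]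
    simp only [LinearEquiv.trans_apply, scalarOp_apply, map_smul, LinearEquiv.apply_symm_apply]

/-! ### along a homomorphism `s : G →* MpPsi ρ₁` -/

variable {G : Type*} [Group G] (s : G →* MpPsi ρ₁)

/-- **the transported section lies over `φ ∘ (proj ∘ s)`**. [cite: MoeglinVignerasWaldspurger1987, Chap. 2 II.1 (B)] -/
theorem MpPsi.proj_congr_comp (g : G) :
    MpPsi.proj ρ₂ (((MpPsi.congr ρ₁ ρ₂ hT hφ).toMonoidHom.comp s) g) = φ (MpPsi.proj ρ₁ (s g)) := rfl

/-- **the Weil representation of the transported section is `T ω_s T⁻¹`**: `ω_{congr ∘ s}(g) (T f) = T (ω_s(g) f)`.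
[cite: MoeglinVignerasWaldspurger1987, Chap. 2 I.7] -/
theorem MpPsi.toRep_congr_comp_apply (g : G) (f : S₁) :
    ((MpPsi.toRep ρ₂).comp ((MpPsi.congr ρ₁ ρ₂ hT hφ).toMonoidHom.comp s)) g (T f) = T (((MpPsi.toRep ρ₁).comp s) g f) :=
  MpPsi.toRep_congr_apply ρ₁ ρ₂ hT hφ (s g) f

end Congr

end Literature.RepresentationTheory.HeisenbergGroup

end
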